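import Literature.MathematicalPhysics.QuantumFieldTheory.Balaban1983to89.B6Prop22SeriesAdjMultiLevelBox

/-!
# `Balaban1983to89.B6Prop22SeriesSixMultiLevelBox` — [B6] PROPOSITION 2.2, THE CONVERGENCE CLAUSE «The random walk
representation (2.50) is convergent in the norms defined by these inequalities» IN ALL SIX NORMS OF (2.67) WITH COMMON
CONSTANTS, IN THE PRINTED QUANTIFIER ORDER, FOR THE GENUINE `k`-LEVEL OPERATOR `G′ = Δ′_a^{−1}` ON A BOX (package of parts 1
and 2, `B6Prop22SeriesMultiLevelBox` + `B6Prop22SeriesAdjMultiLevelBox`; no existing module is touched; no fact is minted)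

FRAMING (verbatim cell line):
statement-level skeleton of published theorems with citation tags; proofs where landed; nothing here is a claim about the Yang–Mills mass gap

Source under audit (cell pub-balaban / lit-balaban): T. Bałaban, *Propagators and renormalization transformations for
lattice gauge theories. II*, Commun. Math. Phys. **96** (1984) 223–250 [`Balaban1984PropagatorsII`, "B6"], p. 234
[PDF 12] (2.67), Proposition 2.2 (last sentence); p. 232 [PDF 10] (2.50) (renders
`run/shared/lean/pub/pub-balaban/b2b-balaban-ref1/pages/1984-cmp96-propagators-rt-II/…-p010/p012-x2.png`); [3] =
T. Bałaban, *Regularity and decay of lattice Green's functions*, Commun. Math. Phys. **89** (1983) 571–597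
[`Balaban1983RegularityDecay`], Theorem (1.9) p. 573 («δ₀ … depending on d, M only, c₀ on α also»).  Unit
`lit-balaban-p21` (Phase-2 proof seat p21 gen 12), HOME `run/shared/lean/pub/lit-balaban/`, B6 fold owner r03 (rows
**B6.Prop2.2**, **B6.Eq2.50**), referee ref-4.

## WHAT IS PRINTED (p. 234, verbatim up to notation)

«**Proposition 2.2.** If we have (2.1), (2.2) and M is sufficiently large, then the operator G′ = Δ′_a^{−1} (a = 1)
satisfies the inequalities |(G′λ)(x)|, |(∇^η_xG′λ)(x)|, |(G′∇^{η*}λ)(x)|, ‖ζ∇^ηG′λ‖_α, ‖ζG′∇^{η*}λ‖_α, |(Δ^ηG′λ)(x)| ≤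
O(1)[(L^jη)², L^jη, L^jη, (L^jη)^{1−α}(‖ζ‖_α + |ζ|), (L^jη)^{1−α}(‖ζ‖_α + |ζ|), 1]·e^{−½δ₀d(y,y′)}|λ| … (2.67)  The random
walk representation (2.50) is convergent in the norms defined by these inequalities.»

## WHAT THIS FILE CERTIFIES (kernel-checked)

`prop22_series_six_multiLevelBox_unif`: ONE rate `δ₀`, ONE threshold pair `M₀`, `N₀` («M sufficiently large», (2.59)) and
ONE constant `C` such that for every `k`, `M_h ≥ 3`, `L·M_h ≥ M₀`, `R ≥ 2L`, `RM ≥ N₀ + 1`, volume, nested family of domains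
(2.1)–(2.2), weights in the windows (`a_{i+1} = aNext ℓ a_i c_i`) and EVERY `N`, the `N`-th remainders of the random walk
representation have majorants `C·2^{−N}·[(L^j)², L^j, L^j, 1]·e^{−½δ₀d(y,y′)}` in the four `α`-free norms (entries 1, 2, 3, 6:
`G′R^N`, `∇_μG′R^N`, `(Rᵀ)^N G′∂_μᵀ`, `(−Δ^N)G′R^N`), AND for every `0 ≤ α < 1` a `C_α` (same `δ₀, M₀, N₀`) with majorants
`C_α·2^{−N}·(L^j)^{1−α}·e^{−½δ₀d}` of the two lifted Hölder functionals (entries 4, 5: `D_α∘∇_μ(G′R^N)` on bond pairs,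
`D_α∘((Rᵀ)^N G′∂_μᵀ)` on pairs) — the conjunction, with common constants, of parts 1 and 2 (`N = 0`: the six entries of (2.67)
themselves, `B6Prop22SixMultiLevelBoxRateUnif`).

## HONEST SCOPE

As parts 1 and 2: entries 1, 2, 4, 6 for the remainders `G′R^N = G′ − G′₀Σ_{n<N}Rⁿ` of (2.50); entries 3, 5 for the remainders
`(Rᵀ)^N G′ = (G′R^N)ᵀ` of the transposed representation `G′ = Σ_n(Rᵀ)ⁿG′₀ᵀ` of the symmetric `G′`; levels `1 … k` on a
Neumann box, `m² = 0`, asymmetric partition, `M_h ≥ 3`, `R ≥ 2L`, lattice units, `L`-dependent (2.61)-constant, constants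
existential.  Nothing is inferred from the manuscript: every step is kernel-checked.  NOT summit progress.
-/

namespace Literature.MathematicalPhysics.QuantumFieldTheory.Balaban1983to89.B6Prop22SeriesSixMultiLevelBox

open Matrix
open Literature.MathematicalPhysics.QuantumFieldTheory.Balaban1983to89.B4Reflection242 (boxDom)
open Literature.MathematicalPhysics.QuantumFieldTheory.Balaban1983to89.B4BoxCov237 (opBoxR)
open Literature.MathematicalPhysics.QuantumFieldTheory.Balaban1983to89.B6Ineq243TwoLevelBox (aNext)
open Literature.MathematicalPhysics.QuantumFieldTheory.Balaban1983to89.B6MultiLevelBoxOperator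
open Literature.MathematicalPhysics.QuantumFieldTheory.Balaban1983to89.B6Eq238MultiLevelBox
open Literature.MathematicalPhysics.QuantumFieldTheory.Balaban1983to89.B6Geom246MultiLevelBox
open Literature.MathematicalPhysics.QuantumFieldTheory.Balaban1983to89.B6Prop22MultiLevelBox
open Literature.MathematicalPhysics.QuantumFieldTheory.Balaban1983to89.B6Prop22DerivMultiLevelBox (dMat)
open Literature.MathematicalPhysics.QuantumFieldTheory.Balaban1983to89.B6Prop22HolderMultiLevelBox (liftL HPair blkP
  holderOp)
open Literature.MathematicalPhysics.QuantumFieldTheory.Balaban1983to89.B6Prop22DualHolderMultiLevelBox (BPair blkB dualOp)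
open Literature.MathematicalPhysics.QuantumFieldTheory.Balaban1983to89.B6RandomWalk (HasMajorant hasMajorant_mono)
open Literature.MathematicalPhysics.QuantumFieldTheory.Balaban1983to89.B6Prop22SeriesMultiLevelBox
  (prop22_series_first_multiLevelBox prop22_series_second_multiLevelBox prop22_series_fourth_multiLevelBox_unif)
open Literature.MathematicalPhysics.QuantumFieldTheory.Balaban1983to89.B6Prop22SeriesAdjMultiLevelBox
  (prop22_series_third_multiLevelBox prop22_series_fifth_multiLevelBox_unif prop22_series_sixth_multiLevelBox)

noncomputable section

variable {d : ℕ}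

/-- **[B6] PROPOSITION 2.2, CONVERGENCE CLAUSE IN ALL SIX NORMS OF (2.67), GENUINE `k`-LEVEL OPERATOR, PRINTED QUANTIFIER
ORDER**: one `δ₀`, one `M₀`, one `N₀` and one `C` for the remainders in the four `α`-free norms (entries 1, 2, 3, 6), and for
every `0 ≤ α < 1` a `C_α` for the remainders in the two Hölder norms (entries 4, 5) at the same `δ₀, M₀, N₀`; every remainder
decays like `2^{−N}`.
[cite: Balaban1984PropagatorsII, Proposition 2.2 p.234 («The random walk representation (2.50) is convergent in the norms defined by these inequalities»), (2.50) p.232, (2.67) p.234] -/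
theorem prop22_series_six_multiLevelBox_unif (d ℓ : ℕ) (hℓ : 1 ≤ ℓ) (aminus aplus a2minus a2plus : ℝ) (ha : 0 < aminus)
    (ha2 : 0 < a2minus) :
    ∃ δ₀ C M₀ : ℝ, ∃ N₀ : ℕ, 0 < δ₀ ∧ 0 < C ∧ 0 < M₀ ∧ 0 < N₀ ∧
      (∀ (k Mh R : ℕ), 3 ≤ Mh → M₀ ≤ ((ℓ : ℝ) + 1) * Mh → 2 * (ℓ + 1) ≤ R → N₀ + 1 ≤ R * ((ℓ + 1) * Mh) →
        ∀ (P : Fin (d + 1) → ℕ) (hP : ∀ μ, 1 ≤ P μ) (D : Domains d ℓ Mh k P R) (a c : ℕ → ℝ),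
          (∀ i, 1 ≤ i → aminus ≤ a i ∧ a i ≤ aplus) → (∀ i, 1 ≤ i → a2minus ≤ c i ∧ c i ≤ a2plus) →
          (∀ i, 1 ≤ i → a (i + 1) = aNext ℓ (a i) (c i)) → ∀ N : ℕ,
          HasMajorant (g := geom D) (blkOf D)
              (Matrix.toLin' (gml (N0 ℓ Mh k P) ℓ k D.lev a * rML D a c hP ^ N))
              (fun y y' => C * (1 / 2) ^ N * ((ℓ : ℝ) + 1) ^ (2 * y.1.1) * Real.exp (-(δ₀ / 2 * (geom D).dist y y')))
            ∧ (∀ μ : Fin (d + 1), HasMajorant (g := geom D) (blkOf D)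
                (Matrix.toLin' (dMat (N0 ℓ Mh k P) μ * gml (N0 ℓ Mh k P) ℓ k D.lev a * rML D a c hP ^ N))
                (fun y y' => C * (1 / 2) ^ N * ((ℓ : ℝ) + 1) ^ y.1.1 * Real.exp (-(δ₀ / 2 * (geom D).dist y y'))))
            ∧ (∀ μ : Fin (d + 1), HasMajorant (g := geom D) (blkOf D)
                (Matrix.toLin' (((rML D a c hP)ᵀ) ^ N
                  * (gml (N0 ℓ Mh k P) ℓ k D.lev a * (dMat (N0 ℓ Mh k P) μ)ᵀ)))
                (fun y y' => C * (1 / 2) ^ N * ((ℓ : ℝ) + 1) ^ y.1.1 * Real.exp (-(δ₀ / 2 * (geom D).dist y y'))))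
            ∧ HasMajorant (g := geom D) (blkOf D)
                (Matrix.toLin' (opBoxR 1 0 0 1 (N0 ℓ Mh k P) * (gml (N0 ℓ Mh k P) ℓ k D.lev a * rML D a c hP ^ N)))
                (fun y y' => C * (1 / 2) ^ N * Real.exp (-(δ₀ / 2 * (geom D).dist y y'))))
      ∧ (∀ (α : ℝ), 0 ≤ α → α < 1 → ∃ Cα : ℝ, 0 < Cα ∧
        ∀ (k Mh R : ℕ), 3 ≤ Mh → M₀ ≤ ((ℓ : ℝ) + 1) * Mh → 2 * (ℓ + 1) ≤ R → N₀ + 1 ≤ R * ((ℓ + 1) * Mh) →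
        ∀ (P : Fin (d + 1) → ℕ) (hP : ∀ μ, 1 ≤ P μ) (D : Domains d ℓ Mh k P R) (a c : ℕ → ℝ),
          (∀ i, 1 ≤ i → aminus ≤ a i ∧ a i ≤ aplus) → (∀ i, 1 ≤ i → a2minus ≤ c i ∧ c i ≤ a2plus) →
          (∀ i, 1 ≤ i → a (i + 1) = aNext ℓ (a i) (c i)) → ∀ (μ : Fin (d + 1)) (N : ℕ),
          HasMajorant (g := geom D) (Sum.elim (blkP D μ) (blkOf D))
              (liftL (holderOp D μ α (gml (N0 ℓ Mh k P) ℓ k D.lev a * rML D a c hP ^ N)))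
              (fun y y' => Cα * (1 / 2) ^ N * (((ℓ : ℝ) + 1) ^ y.1.1) ^ (1 - α)
                * Real.exp (-(δ₀ / 2 * (geom D).dist y y')))
          ∧ HasMajorant (g := geom D) (Sum.elim (blkB D) (blkOf D))
              (liftL (dualOp D α (((rML D a c hP)ᵀ) ^ N
                * (gml (N0 ℓ Mh k P) ℓ k D.lev a * (dMat (N0 ℓ Mh k P) μ)ᵀ))))
              (fun y y' => Cα * (1 / 2) ^ N * (((ℓ : ℝ) + 1) ^ y.1.1) ^ (1 - α)
                * Real.exp (-(δ₀ / 2 * (geom D).dist y y')))) := by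
  obtain ⟨δ₁, C₁, M₁, N₁, hδ₁, hC₁, hM₁, hN₁, h1⟩ :=
    prop22_series_first_multiLevelBox d ℓ hℓ aminus aplus a2minus a2plus ha ha2
  obtain ⟨δ₂, C₂, M₂, N₂, hδ₂, hC₂, hM₂, hN₂, h2⟩ :=
    prop22_series_second_multiLevelBox d ℓ hℓ aminus aplus a2minus a2plus ha ha2
  obtain ⟨δ₃, C₃, M₃, N₃, hδ₃, hC₃, hM₃, hN₃, h3⟩ :=
    prop22_series_third_multiLevelBox d ℓ hℓ aminus aplus a2minus a2plus ha ha2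
  obtain ⟨δ₆, C₆, M₆, N₆, hδ₆, hC₆, hM₆, hN₆, h6⟩ :=
    prop22_series_sixth_multiLevelBox d ℓ hℓ aminus aplus a2minus a2plus ha ha2
  obtain ⟨δ₄, M₄, N₄, hδ₄, hM₄, hN₄, h4A⟩ :=
    prop22_series_fourth_multiLevelBox_unif d ℓ hℓ aminus aplus a2minus a2plus ha ha2
  obtain ⟨δ₅, M₅, N₅, hδ₅, hM₅, hN₅, h5A⟩ :=
    prop22_series_fifth_multiLevelBox_unif d ℓ hℓ aminus aplus a2minus a2plus ha ha2
  -- the common rate and its comparisons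
  obtain ⟨δ₀, hδ₀⟩ : ∃ δ₀ : ℝ, δ₀ = min (min (min δ₁ δ₂) (min δ₃ δ₆)) (min δ₄ δ₅) := ⟨_, rfl⟩
  have hδ₀pos : 0 < δ₀ := by
    rw [hδ₀]; exact lt_min (lt_min (lt_min hδ₁ hδ₂) (lt_min hδ₃ hδ₆)) (lt_min hδ₄ hδ₅)
  have hle1 : δ₀ ≤ δ₁ := by
    rw [hδ₀]; exact ((min_le_left _ _).trans (min_le_left _ _)).trans (min_le_left _ _)
  have hle2 : δ₀ ≤ δ₂ := by
    rw [hδ₀]; exact ((min_le_left _ _).trans (min_le_left _ _)).trans (min_le_right _ _)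
  have hle3 : δ₀ ≤ δ₃ := by
    rw [hδ₀]; exact ((min_le_left _ _).trans (min_le_right _ _)).trans (min_le_left _ _)
  have hle6 : δ₀ ≤ δ₆ := by
    rw [hδ₀]; exact ((min_le_left _ _).trans (min_le_right _ _)).trans (min_le_right _ _)
  have hle4 : δ₀ ≤ δ₄ := by rw [hδ₀]; exact (min_le_right _ _).trans (min_le_left _ _)
  have hle5 : δ₀ ≤ δ₅ := by rw [hδ₀]; exact (min_le_right _ _).trans (min_le_right _ _)
  -- the weakening of a majorant `Cc·q·p·e^{−δd/2}` to the common rate and a larger constant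
  have hweak : ∀ {k Mh R : ℕ} {P : Fin (d + 1) → ℕ} (D : Domains d ℓ Mh k P R), 1 ≤ Mh → (∀ μ, 1 ≤ P μ) →
      ∀ (δ Cc Cmax : ℝ), δ₀ ≤ δ → 0 ≤ Cc → Cc ≤ Cmax →
      ∀ (q p : ℝ), 0 ≤ q → 0 ≤ p → ∀ y y' : (geom D).Site,
        Cc * q * p * Real.exp (-(δ / 2 * (geom D).dist y y'))
          ≤ Cmax * q * p * Real.exp (-(δ₀ / 2 * (geom D).dist y y')) := by
    intro k Mh R P D hMh1 hP δ Cc Cmax hδ hC0 hCle q p hq hp y y'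
    have hdnn : 0 ≤ (geom D).dist y y' := (triangle_refl_nonneg D hMh1 hP).2.2 y y'
    have he : Real.exp (-(δ / 2 * (geom D).dist y y')) ≤ Real.exp (-(δ₀ / 2 * (geom D).dist y y')) := by
      rw [Real.exp_le_exp, neg_le_neg_iff]
      exact mul_le_mul_of_nonneg_right (by linarith) hdnn
    exact mul_le_mul (mul_le_mul_of_nonneg_right (mul_le_mul_of_nonneg_right hCle hq) hp) he (Real.exp_pos _).le
      (mul_nonneg (mul_nonneg (hC0.trans hCle) hq) hp)
  refine ⟨δ₀, C₁ + C₂ + C₃ + C₆, M₁ + M₂ + M₃ + M₆ + M₄ + M₅, N₁ + N₂ + N₃ + N₆ + N₄ + N₅, hδ₀pos, by positivity,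
    by positivity, by omega, ?_, fun α hα0 hα1 => ?_⟩
  · intro k Mh R hMh hM hR hRM P hP D a c haw hcw hac N
    have hMh1 : 1 ≤ Mh := le_trans (by norm_num) hMh
    have hq : (0 : ℝ) ≤ (1 / 2) ^ N := pow_nonneg (by norm_num) N
    have hM1 : M₁ ≤ ((ℓ : ℝ) + 1) * Mh := by linarith
    have hM2 : M₂ ≤ ((ℓ : ℝ) + 1) * Mh := by linarith
    have hM3 : M₃ ≤ ((ℓ : ℝ) + 1) * Mh := by linarith
    have hM6 : M₆ ≤ ((ℓ : ℝ) + 1) * Mh := by linarith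
    have hN1 : N₁ + 1 ≤ R * ((ℓ + 1) * Mh) := le_trans (by omega) hRM
    have hN2 : N₂ + 1 ≤ R * ((ℓ + 1) * Mh) := le_trans (by omega) hRM
    have hN3 : N₃ + 1 ≤ R * ((ℓ + 1) * Mh) := le_trans (by omega) hRM
    have hN6 : N₆ + 1 ≤ R * ((ℓ + 1) * Mh) := le_trans (by omega) hRM
    have hC1 : C₁ ≤ C₁ + C₂ + C₃ + C₆ := by linarith
    have hC2 : C₂ ≤ C₁ + C₂ + C₃ + C₆ := by linarith
    have hC3 : C₃ ≤ C₁ + C₂ + C₃ + C₆ := by linarith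
    have hC6 : C₆ ≤ C₁ + C₂ + C₃ + C₆ := by linarith
    refine ⟨?_, fun μ => ?_, fun μ => ?_, ?_⟩
    · refine hasMajorant_mono (g := geom D) (blkOf D) (h1 k Mh R hMh hM1 hR hN1 P hP D a c haw hcw hac N).2
        fun y y' => ?_
      exact hweak D hMh1 hP δ₁ C₁ _ hle1 hC₁.le hC1 _ _ hq (by positivity) y y'
    · refine hasMajorant_mono (g := geom D) (blkOf D) (h2 k Mh R hMh hM2 hR hN2 P hP D a c haw hcw hac μ N).2
        fun y y' => ?_
      exact hweak D hMh1 hP δ₂ C₂ _ hle2 hC₂.le hC2 _ _ hq (by positivity) y y'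
    · refine hasMajorant_mono (g := geom D) (blkOf D) (h3 k Mh R hMh hM3 hR hN3 P hP D a c haw hcw hac μ N)
        fun y y' => ?_
      exact hweak D hMh1 hP δ₃ C₃ _ hle3 hC₃.le hC3 _ _ hq (by positivity) y y'
    · refine hasMajorant_mono (g := geom D) (blkOf D) (h6 k Mh R hMh hM6 hR hN6 P hP D a c haw hcw hac N)
        fun y y' => ?_
      have h := hweak D hMh1 hP δ₆ C₆ _ hle6 hC₆.le hC6 _ 1 hq zero_le_one y y'
      simp only [mul_one] at h
      exact h
  · obtain ⟨C₄, hC₄, h4⟩ := h4A α hα0 hα1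
    obtain ⟨C₅, hC₅, h5⟩ := h5A α hα0 hα1
    refine ⟨C₄ + C₅, by positivity, ?_⟩
    intro k Mh R hMh hM hR hRM P hP D a c haw hcw hac μ N
    have hMh1 : 1 ≤ Mh := le_trans (by norm_num) hMh
    have hq : (0 : ℝ) ≤ (1 / 2) ^ N := pow_nonneg (by norm_num) N
    have hM4 : M₄ ≤ ((ℓ : ℝ) + 1) * Mh := by linarith
    have hM5 : M₅ ≤ ((ℓ : ℝ) + 1) * Mh := by linarith
    have hN4 : N₄ + 1 ≤ R * ((ℓ + 1) * Mh) := le_trans (by omega) hRM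
    have hN5 : N₅ + 1 ≤ R * ((ℓ + 1) * Mh) := le_trans (by omega) hRM
    refine ⟨?_, ?_⟩
    · refine hasMajorant_mono (g := geom D) (Sum.elim (blkP D μ) (blkOf D))
        (h4 k Mh R hMh hM4 hR hN4 P hP D a c haw hcw hac μ N).2 fun y y' => ?_
      exact hweak D hMh1 hP δ₄ C₄ (C₄ + C₅) hle4 hC₄.le (by linarith) _ _ hq
        (Real.rpow_nonneg (by positivity) _) y y'
    · refine hasMajorant_mono (g := geom D) (Sum.elim (blkB D) (blkOf D))
        (h5 k Mh R hMh hM5 hR hN5 P hP D a c haw hcw hac μ N) fun y y' => ?_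
      exact hweak D hMh1 hP δ₅ C₅ (C₄ + C₅) hle5 hC₅.le (by linarith) _ _ hq
        (Real.rpow_nonneg (by positivity) _) y y'

end

end Literature.MathematicalPhysics.QuantumFieldTheory.Balaban1983to89.B6Prop22SeriesSixMultiLevelBox
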